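import Summits.KontsevichZagierPeriods.Zeta5Search.Certificates.ModRedLK3Sum
import Summits.KontsevichZagierPeriods.Zeta5Search.Certificates.ModRedNKAll
import HarnessLib

/-!
# ζ(5) search — brown9 LEVEL 2: the relation (L-K3) for EVERY rational `k₃` (cell `pub-zeta5`, certifier `cert-2`)

HONEST FRAMING: systematic search; recurrence certificates; no irrationality claim unless certified.

`Certificates/ModRedLK3Sum.lean` proved the ttrl2 lane's pure `k₃`-shift relation (L-K3) of fam-brown9's triple sum,
`η₀L(n,x) + η₁L(n,x+1) + η₂L(n,x+2) + η₃L(n,x+3) = 0`, for `n ≥ 2` and NON-INTEGRAL rational `x` (the module reduction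
divides by linear forms that vanish only at integers). As for (R-NK) (`ModRedNKAll`), the gap is closed by POLYNOMIALITY:
both arguments of the first tensor factor `T(n;3n−x−k,3n−x)` move with `x`, so we add `polyRep_T2` (`x ↦ T(n;a−x,b−x)`
is polynomial) to cert-1's `PolyRep` toolkit; the left-hand side is then a polynomial function of `x` vanishing on the
infinite set of non-integers, hence everywhere: `L_rel_K3_all (n ≥ 2) (x : ℚ)`.
-/

noncomputable section

namespace Summit.KontsevichZagierPeriods.Zeta5Search.Certificates

namespace VIMInner.ModRed

open Finset Polynomial
open Summit.KontsevichZagierPeriods.Zeta5Search.PolyReflect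

/-- `x ↦ T(n; a − x, b − x)` is polynomial in `x` (both arguments moving). -/
def polyRep_T2 (n : ℕ) (a b : ℚ) : PolyRep fun x => T n (a - x) (b - x) := by
  unfold T tT
  refine PolyRep.sum (range (n + 1)) fun j => ?_
  have h1 : PolyRep fun x => bp n (a - x - j) :=
    polyRep_bp n (((PolyRep.const a).sub PolyRep.id).sub (PolyRep.const _))
  have h2 : PolyRep fun x => bp n (b - x - j) :=
    polyRep_bp n (((PolyRep.const b).sub PolyRep.id).sub (PolyRep.const _))
  exact (((PolyRep.const _).mul (PolyRep.const _)).mul h1).mul h2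

/-- `x ↦ sL(n, x + c, k)` is polynomial in `x`. -/
def polyRep_sL (n : ℕ) (c : ℚ) (k : ℕ) : PolyRep fun x => sL n (x + c) k := by
  have e : ∀ x, sL n (x + c) k =
      ((-1) ^ k * ((n.choose k : ℕ) : ℚ)) * (T n ((3 * (n : ℚ) - c - k) - x) ((3 * (n : ℚ) - c) - x)
        * T n ((3 * (n : ℚ) - c - k) - x) (2 * (n : ℚ) - k)) := by
    intro x; unfold sL; ring_nf
  have h := ((PolyRep.const ((-1 : ℚ) ^ k * ((n.choose k : ℕ) : ℚ))).mul
    (polyRep_T2 n (3 * (n : ℚ) - c - k) (3 * (n : ℚ) - c))).mul (polyRep_T n (3 * (n : ℚ) - c - k) (2 * (n : ℚ) - k))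
  exact ⟨h.poly, fun x => by rw [e x]; simpa [mul_assoc] using h.eval_eq x⟩

/-- `x ↦ L(n, x + c)` is polynomial in `x`. -/
def polyRep_Lsum (n : ℕ) (c : ℚ) : PolyRep fun x => Lsum n (x + c) := by
  unfold Lsum
  exact PolyRep.sum (range (n + 1)) fun k => polyRep_sL n c k

/-- The (L-K3) combination as a polynomially represented function of `x`. -/
def polyRep_LK3 (n : ℕ) :
    PolyRep fun x => ev2 etaL0 n x * Lsum n x + ev2 etaL1 n x * Lsum n (x + 1) + ev2 etaL2 n x * Lsum n (x + 2)
      + ev2 etaL3 n x * Lsum n (x + 3) := by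
  have h0 : PolyRep fun x => Lsum n x := by
    have h := polyRep_Lsum n 0
    exact ⟨h.poly, fun x => by rw [← add_zero x, h.eval_eq x, add_zero]⟩
  exact ((((polyRep_ev2 n etaL0).mul h0).add ((polyRep_ev2 n etaL1).mul (polyRep_Lsum n 1))).add
    ((polyRep_ev2 n etaL2).mul (polyRep_Lsum n 2))).add ((polyRep_ev2 n etaL3).mul (polyRep_Lsum n 3))

/-- **(L-K3), all `x`** (cert-2): for `n ≥ 2` and EVERY rational `x` (in particular every integer `k₃`),
`η₀(n,x)L(n,x) + η₁(n,x)L(n,x+1) + η₂(n,x)L(n,x+2) + η₃(n,x)L(n,x+3) = 0` — the ttrl2 lane's pure `k₃`-shift relation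
of fam-brown9's triple sum `L` ("vanishing in the middle" leading coefficient), `η_j = ev2 etaLj` (integer data). -/
theorem L_rel_K3_all (n : ℕ) (hn : 2 ≤ n) (x : ℚ) :
    ev2 etaL0 n x * Lsum n x + ev2 etaL1 n x * Lsum n (x + 1) + ev2 etaL2 n x * Lsum n (x + 2)
      + ev2 etaL3 n x * Lsum n (x + 3) = 0 :=
  PolyRep.eq_zero_of_not_int (polyRep_LK3 n) (fun y hy => L_rel_K3 n hn y hy) x

/-- The leading coefficient of (L-K3) in closed form: `η₃(n,x) = (x−2n)²(x−2n+1)²(x−2n+2)²`, non-zero for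
non-integral `x` and for every integer `x ∉ {2n−2, 2n−1, 2n}` — so (L-K3) determines `L(n,x+3)` from three predecessors. -/
theorem etaL3_eq (w x : ℚ) : ev2 etaL3 w x = (x - 2 * w) ^ 2 * (x - 2 * w + 1) ^ 2 * (x - 2 * w + 2) ^ 2 := by
  simp [etaL3, ev2, ev1]; ring

/-- The trailing coefficient of (L-K3): `η₀(n,x) = −(x+1)(x−2n)⁵`. -/
theorem etaL0_eq (w x : ℚ) : ev2 etaL0 w x = -((x + 1) * (x - 2 * w) ^ 5) := by
  simp [etaL0, ev2, ev1]; ring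

end VIMInner.ModRed

end Summit.KontsevichZagierPeriods.Zeta5Search.Certificates
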